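import Mathlib
import Literature.Analysis.Matrix.SylvesterInertiaCertificate
import Summits.ValiantsHypothesis.ValiantsHypothesis.Theorems.KPlusLogSqLawWeakLiftingTowerGraftSignedCrossingFrame

/-!
# Tower graft line — SIGNED CROSSINGS II: a Finsler–Debreu lemma and the two local inertia laws
# (negative inertia is an OPEN condition; against a TRANSVERSAL direction the non-positive inertia becomes negative)

Structure file for LINE (B) `Cruxes/WeakLifting/Lines/tower_graft.lean` (crux `WeakLifting` = stmt-ValiantsHypothesis-19561),
second of the SIGNED-CROSSING series; static perturbation laws for a real symmetric `A : Matrix ι ι ℝ` (spectrum `hA.eigenvalues`),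
sizes measured by the entrywise `ℓ¹` norm `Σ_{i,j} |M i j|`:

§1 `exists_margin_of_posDef_on_ker` — FINSLER–DEBREU LEMMA (quadratic-form version, by compactness of the dot-product sphere
   `isCompact_dotSphere` and homogeneity `forall_of_forall_dotSphere`): `B ⪰ 0` and `cᵀPc > 0` for every `c ≠ 0` with `Bc = 0`
   ⇒ `∃ α ≥ 0, μ > 0, ∀ c, μ (c ⬝ c) ≤ cᵀPc + α·cᵀBc` (no symmetry of `P` needed); `exists_margin_of_pos` — the case `B = 0`.
§2 `exists_negCount_le_of_near` — NEGATIVE INERTIA IS OPEN: `∃ μ > 0`, every real symmetric `M` with `Σ|M − A| < μ` has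
   `#{λ_i(A) < 0} ≤ #{λ_i(M) < 0}` (trial subspace = the negative eigen-frame of `A`, margin from §1).
§3 `exists_nonposCount_le_of_near_transversal` — THE TRANSVERSAL JUMP: if `vᵀA′v > 0` for every `v ≠ 0` in `ker A`, then
   `∃ μ > 0, s₀ > 0` such that for `0 < s ≤ s₀` every real symmetric `M` with `Σ|M − (A − s•A′)| < μ·s` has
   `#{λ_i(A) ≤ 0} ≤ #{λ_i(M) < 0}` (trial subspace = the non-positive eigen-frame `V`; the margin is §1 for the compressions
   `B = −VᵀAV ⪰ 0`, `P = VᵀA′V`, positive on `ker B` because there `Vc ∈ ker A`).  Applied to `−A` it yields the mirror law for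
   `#{λ_i(A) ≥ 0}` along `A + s•A′` (`…SignedCrossingLaw`).
Mechanism: Courant–Fischer trial subspaces in the tree's counting form (`EigenvalueCount.card_le_card_eigenvalues_lt`) on the
eigen-frames of `…SignedCrossingFrame`.  Def-free.  Seat: prover val-sym-lift-p2 g24, `--supports stmt-ValiantsHypothesis-19561
--as helper`.  Zero stub credit; S4/S5, TowerB, WeakLifting, Conjecture B, 18050, VP ≠ VNP untouched.  [folklore: Finsler 1937 /
Debreu 1952 (forms positive on the kernel of a semidefinite form), first-order perturbation of a semisimple eigenvalue in counting
form (Kato II.5.4); the packaging for the line is this work]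
-/

-- `Summit.ValiantsHypothesis.ValiantsHypothesis.…` repeats a component by the D-0017 layout
-- (single-conjunct summit), which the `dupNamespace` linter flags; the name is mandated.
set_option linter.dupNamespace false
set_option autoImplicit false

namespace Summit.ValiantsHypothesis.ValiantsHypothesis.Theorems.KPlusLogSqLaw.TowerGraft

open Matrix Finset
open scoped BigOperators Topology
open Literature.Analysis.Matrix (EigenvalueCount.card_le_card_eigenvalues_lt)

namespace SignedCrossing

variable {ι : Type} [Fintype ι] [DecidableEq ι]

/-! ## §1 A Finsler–Debreu lemma (quadratic-form version) -/

section Debreu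

variable {κ : Type} [Fintype κ]

omit [Fintype ι] [DecidableEq ι] in
/-- the dot-product unit sphere `{c | c ⬝ c = 1}` of `κ → ℝ` is compact. [folklore] -/
theorem isCompact_dotSphere : IsCompact {c : κ → ℝ | c ⬝ᵥ c = 1} := by
  refine Metric.isCompact_of_isClosed_isBounded ?_ ?_
  · exact isClosed_eq (continuous_id.dotProduct continuous_id) continuous_const
  · rw [Metric.isBounded_iff_subset_closedBall (0 : κ → ℝ)]
    refine ⟨1, fun c hc => ?_⟩
    rw [Set.mem_setOf_eq] at hc
    rw [Metric.mem_closedBall, dist_zero_right, pi_norm_le_iff_of_nonneg zero_le_one]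
    intro i
    rw [Real.norm_eq_abs]
    have hsq : c i * c i ≤ 1 := by
      rw [← hc]
      unfold dotProduct
      exact Finset.single_le_sum (fun j _ => mul_self_nonneg (c j)) (Finset.mem_univ i)
    exact abs_le_one_iff_mul_self_le_one.mpr hsq

omit [Fintype ι] [DecidableEq ι] in
/-- homogeneity: a quadratic-form inequality on the dot-product sphere holds everywhere. [folklore] -/
theorem forall_of_forall_dotSphere (Q : Matrix κ κ ℝ) {μ : ℝ}
    (h : ∀ c : κ → ℝ, c ⬝ᵥ c = 1 → μ ≤ c ⬝ᵥ Q *ᵥ c) (c : κ → ℝ) : μ * (c ⬝ᵥ c) ≤ c ⬝ᵥ Q *ᵥ c := by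
  by_cases hc : c = 0
  · subst hc
    simp
  · have hpos : 0 < c ⬝ᵥ c := by
      have h1 := dotProduct_star_self_pos_iff.mpr hc
      simpa using h1
    set r : ℝ := Real.sqrt (c ⬝ᵥ c) with hr
    have hr0 : 0 < r := Real.sqrt_pos.mpr hpos
    have hrr : r * r = c ⬝ᵥ c := Real.mul_self_sqrt hpos.le
    have hunit : (r⁻¹ • c) ⬝ᵥ (r⁻¹ • c) = 1 := by
      rw [smul_dotProduct, dotProduct_smul, smul_eq_mul, smul_eq_mul, ← hrr]
      field_simp
    have h1 := h (r⁻¹ • c) hunit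
    rw [Matrix.mulVec_smul, smul_dotProduct, dotProduct_smul, smul_eq_mul, smul_eq_mul] at h1
    have h2 : μ * (r * r) ≤ r * r * (r⁻¹ * (r⁻¹ * (c ⬝ᵥ Q *ᵥ c))) :=
      by nlinarith [mul_pos hr0 hr0]
    have h3 : r * r * (r⁻¹ * (r⁻¹ * (c ⬝ᵥ Q *ᵥ c))) = c ⬝ᵥ Q *ᵥ c := by
      field_simp
    rw [h3, hrr] at h2
    exact h2

omit [Fintype ι] [DecidableEq ι] in
/-- **Finsler–Debreu lemma** (quadratic forms on `κ → ℝ`).  `B ⪰ 0`, and `cᵀPc > 0` for every `c ≠ 0` with `Bc = 0`: then for some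
`α ≥ 0` and `μ > 0`, `μ (c ⬝ c) ≤ cᵀPc + α·cᵀBc` for all `c` — a form positive on the kernel of a positive semidefinite form becomes
uniformly positive after adding a large multiple of it.  Proof by compactness of the sphere: on the compact set where `cᵀPc ≤ 0` the
form `cᵀBc` is positive, hence bounded below by some `g₀ > 0`, and `α = (Σ|P| + 1)/g₀` works. [folklore: Finsler 1937, Debreu 1952;
proof here] -/
theorem exists_margin_of_posDef_on_ker (B P : Matrix κ κ ℝ) (hB : B.PosSemidef)
    (hP : ∀ c : κ → ℝ, c ≠ 0 → B *ᵥ c = 0 → 0 < c ⬝ᵥ P *ᵥ c) :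
    ∃ α μ : ℝ, 0 ≤ α ∧ 0 < μ ∧ ∀ c : κ → ℝ, μ * (c ⬝ᵥ c) ≤ c ⬝ᵥ P *ᵥ c + α * (c ⬝ᵥ B *ᵥ c) := by
  classical
  set S : Set (κ → ℝ) := {c | c ⬝ᵥ c = 1} with hS
  have hSc : IsCompact S := isCompact_dotSphere
  have hf : Continuous fun c : κ → ℝ => c ⬝ᵥ P *ᵥ c :=
    continuous_id.dotProduct (continuous_const.matrix_mulVec continuous_id)
  have hg : Continuous fun c : κ → ℝ => c ⬝ᵥ B *ᵥ c :=
    continuous_id.dotProduct (continuous_const.matrix_mulVec continuous_id)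
  have hg0 : ∀ c : κ → ℝ, 0 ≤ c ⬝ᵥ B *ᵥ c := fun c => by simpa using hB.dotProduct_mulVec_nonneg c
  -- on the part of the sphere where `P` is not positive, `B` is positive
  set T : Set (κ → ℝ) := S ∩ {c | c ⬝ᵥ P *ᵥ c ≤ 0} with hT
  have hTc : IsCompact T := hSc.inter_right (isClosed_le hf continuous_const)
  have hTpos : ∀ c ∈ T, 0 < c ⬝ᵥ B *ᵥ c := by
    intro c hc
    rcases (hg0 c).eq_or_lt with h0 | hlt
    · exfalso
      have hBc : B *ᵥ c = 0 := (hB.dotProduct_mulVec_zero_iff c).mp (by simpa using h0.symm)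
      have hc1 : c ⬝ᵥ c = 1 := hc.1
      have hcne : c ≠ 0 := by
        intro h
        rw [h, dotProduct_zero] at hc1
        exact zero_ne_one hc1
      exact absurd hc.2 (not_le.mpr (hP c hcne hBc))
    · exact hlt
  -- the size of `P` bounds its form on the sphere
  have hPbd : ∀ c ∈ S, -(∑ i, ∑ j, |P i j|) ≤ c ⬝ᵥ P *ᵥ c := by
    intro c hc
    have h1 := abs_dotProduct_mulVec_le P c
    rw [show c ⬝ᵥ c = 1 from hc, mul_one] at h1
    exact neg_le_of_abs_le h1
  -- choose `α`
  obtain ⟨α, hα0, hαpos⟩ : ∃ α : ℝ, 0 ≤ α ∧ ∀ c ∈ S, 0 < c ⬝ᵥ P *ᵥ c + α * (c ⬝ᵥ B *ᵥ c) := by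
    rcases T.eq_empty_or_nonempty with hTe | hTne
    · refine ⟨0, le_rfl, fun c hc => ?_⟩
      rw [zero_mul, add_zero]
      by_contra hle
      have : c ∈ T := ⟨hc, not_lt.mp hle⟩
      rw [hTe] at this
      exact this
    · obtain ⟨c₁, hc₁T, hc₁min⟩ := hTc.exists_isMinOn hTne hg.continuousOn
      set g₀ := c₁ ⬝ᵥ B *ᵥ c₁ with hg₀
      have hg₀pos : 0 < g₀ := hTpos c₁ hc₁T
      refine ⟨((∑ i, ∑ j, |P i j|) + 1) / g₀, div_nonneg (by positivity) hg₀pos.le, fun c hc => ?_⟩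
      by_cases hPc : 0 < c ⬝ᵥ P *ᵥ c
      · have : 0 ≤ ((∑ i, ∑ j, |P i j|) + 1) / g₀ * (c ⬝ᵥ B *ᵥ c) :=
          mul_nonneg (div_nonneg (by positivity) hg₀pos.le) (hg0 c)
        linarith
      · have hcT : c ∈ T := ⟨hc, not_lt.mp hPc⟩
        have hgc : g₀ ≤ c ⬝ᵥ B *ᵥ c := hc₁min hcT
        have h1 := hPbd c hc
        have h2 : ((∑ i, ∑ j, |P i j|) + 1) / g₀ * (c ⬝ᵥ B *ᵥ c) ≥ (∑ i, ∑ j, |P i j|) + 1 := by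
          rw [ge_iff_le, div_mul_eq_mul_div, le_div_iff₀ hg₀pos]
          exact mul_le_mul_of_nonneg_left hgc (by positivity)
        linarith
  -- the combined form is positive on the compact sphere, hence bounded below by a positive constant
  have hF : Continuous fun c : κ → ℝ => c ⬝ᵥ P *ᵥ c + α * (c ⬝ᵥ B *ᵥ c) := hf.add (continuous_const.mul hg)
  have hcomb : ∀ c : κ → ℝ, c ⬝ᵥ P *ᵥ c + α * (c ⬝ᵥ B *ᵥ c) = c ⬝ᵥ (P + α • B) *ᵥ c := by
    intro c
    rw [Matrix.add_mulVec, dotProduct_add, Matrix.smul_mulVec, dotProduct_smul, smul_eq_mul]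
  rcases S.eq_empty_or_nonempty with hSe | hSne
  · refine ⟨α, 1, hα0, one_pos, fun c => ?_⟩
    rw [hcomb c]
    refine forall_of_forall_dotSphere (P + α • B) (fun c' hc' => ?_) c
    have : c' ∈ S := hc' 
    rw [hSe] at this
    exact this.elim
  · obtain ⟨c₀, hc₀S, hc₀min⟩ := hSc.exists_isMinOn hSne hF.continuousOn
    refine ⟨α, c₀ ⬝ᵥ P *ᵥ c₀ + α * (c₀ ⬝ᵥ B *ᵥ c₀), hα0, hαpos c₀ hc₀S, fun c => ?_⟩
    rw [hcomb c]
    refine forall_of_forall_dotSphere (P + α • B) (fun c' hc' => ?_) c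
    rw [← hcomb c']
    exact hc₀min hc' 

omit [Fintype ι] [DecidableEq ι] in
/-- a form positive off `0` has a uniform margin: `∃ μ > 0, μ (c ⬝ c) ≤ cᵀPc`. [folklore] -/
theorem exists_margin_of_pos (P : Matrix κ κ ℝ) (hP : ∀ c : κ → ℝ, c ≠ 0 → 0 < c ⬝ᵥ P *ᵥ c) :
    ∃ μ : ℝ, 0 < μ ∧ ∀ c : κ → ℝ, μ * (c ⬝ᵥ c) ≤ c ⬝ᵥ P *ᵥ c := by
  classical
  obtain ⟨α, μ, -, hμ, h⟩ := exists_margin_of_posDef_on_ker (0 : Matrix κ κ ℝ) P Matrix.PosSemidef.zero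
    (fun c hc _ => hP c hc)
  exact ⟨μ, hμ, fun c => by simpa using h c⟩

end Debreu

/-! ## §2 Negative inertia is an open condition -/

/-- **negative inertia is open**: for a real symmetric `A` there is `μ > 0` such that every real symmetric `M` with
`Σ_{i,j} |M i j − A i j| < μ` has at least as many negative eigenvalues as `A` (trial subspace = the negative eigenvectors of `A`,
on which `A ≤ −μ`). [folklore: Horn–Johnson Cor. 4.2.12 + continuity; packaging this work] -/
theorem exists_negCount_le_of_near {A : Matrix ι ι ℝ} (hA : A.IsHermitian) :
    ∃ μ : ℝ, 0 < μ ∧ ∀ (M : Matrix ι ι ℝ) (hM : M.IsHermitian), (∑ i, ∑ j, |(M - A) i j|) < μ →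
      (univ.filter fun i => hA.eigenvalues i < 0).card ≤ (univ.filter fun i => hM.eigenvalues i < 0).card := by
  classical
  -- the frame of negative eigenvectors and its margin
  let p : ℝ → Prop := fun x => x < 0
  let V : Matrix ι {i // p (hA.eigenvalues i)} ℝ := Matrix.of fun x j => (hA.eigenvectorBasis j.1).ofLp x
  obtain ⟨μ, hμ, hmargin⟩ : ∃ μ : ℝ, 0 < μ ∧ ∀ c : {i // p (hA.eigenvalues i)} → ℝ,
      μ * (c ⬝ᵥ c) ≤ c ⬝ᵥ (-(Vᵀ * A * V)) *ᵥ c := by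
    refine exists_margin_of_pos _ fun c hc => ?_
    have hform : c ⬝ᵥ (-(Vᵀ * A * V)) *ᵥ c = -((V *ᵥ c) ⬝ᵥ A *ᵥ (V *ᵥ c)) := by
      rw [Matrix.neg_mulVec, dotProduct_neg, ← Matrix.mulVec_mulVec, ← Matrix.mulVec_mulVec, dotProduct_mulVec,
        vecMul_transpose]
    rw [hform, frame_mulVec_dotProduct_mulVec hA p c, ← Finset.sum_neg_distrib]
    obtain ⟨j, hj⟩ : ∃ j, c j ≠ 0 := by
      by_contra h
      exact hc (funext fun j => by simpa using not_exists.mp h j)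
    refine lt_of_lt_of_le ?_ (Finset.single_le_sum (fun k _ => ?_) (Finset.mem_univ j))
    · have h1 : hA.eigenvalues j.1 < 0 := j.2
      have h2 : 0 < c j ^ 2 := by positivity
      nlinarith
    · have h1 : hA.eigenvalues k.1 < 0 := k.2
      nlinarith [sq_nonneg (c k)]
  refine ⟨μ, hμ, fun M hM hnear => ?_⟩
  rw [← card_frame hA p]
  refine EigenvalueCount.card_le_card_eigenvalues_lt hM V fun c hc => ?_
  rw [zero_mul]
  -- `(Vc)ᵀ M (Vc) = (Vc)ᵀ A (Vc) + (Vc)ᵀ (M - A) (Vc) ≤ -μ (c⬝c) + (Σ|M - A|)(c⬝c) < 0`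
  have hsplit : (V *ᵥ c) ⬝ᵥ M *ᵥ (V *ᵥ c) = (V *ᵥ c) ⬝ᵥ A *ᵥ (V *ᵥ c) + (V *ᵥ c) ⬝ᵥ (M - A) *ᵥ (V *ᵥ c) := by
    rw [Matrix.sub_mulVec, dotProduct_sub]
    ring
  have hA' : (V *ᵥ c) ⬝ᵥ A *ᵥ (V *ᵥ c) ≤ -(μ * (c ⬝ᵥ c)) := by
    have h1 := hmargin c
    have hform : c ⬝ᵥ (-(Vᵀ * A * V)) *ᵥ c = -((V *ᵥ c) ⬝ᵥ A *ᵥ (V *ᵥ c)) := by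
      rw [Matrix.neg_mulVec, dotProduct_neg, ← Matrix.mulVec_mulVec, ← Matrix.mulVec_mulVec, dotProduct_mulVec,
        vecMul_transpose]
    rw [hform] at h1
    linarith
  have hE := (abs_dotProduct_mulVec_le (M - A) (V *ᵥ c)).trans_eq' rfl
  have hE' : (V *ᵥ c) ⬝ᵥ (M - A) *ᵥ (V *ᵥ c) ≤ (∑ i, ∑ j, |(M - A) i j|) * (c ⬝ᵥ c) := by
    rw [← frame_mulVec_dotProduct_self hA p c]
    exact (le_abs_self _).trans (abs_dotProduct_mulVec_le (M - A) (V *ᵥ c))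
  have hcc : 0 < c ⬝ᵥ c := by
    have h1 := dotProduct_star_self_pos_iff.mpr hc
    simpa using h1
  rw [hsplit]
  nlinarith [mul_lt_mul_of_pos_right hnear hcc]

/-! ## §3 The transversal jump -/

/-- **the transversal jump.**  `A` real symmetric, `A′` any real matrix with `vᵀA′v > 0` for every `v ≠ 0` in `ker A`.  Then there are
`μ > 0` and `s₀ > 0` such that for every `0 < s ≤ s₀` and every real symmetric `M` with `Σ_{i,j} |M − (A − s•A′)| < μ·s`, the matrix `M`
has at least `#{i | λ_i(A) ≤ 0}` negative eigenvalues: moving against a direction that is positive on the kernel turns the whole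
non-positive inertia of `A` negative (trial subspace = eigenvectors of `A` with `λ ≤ 0`; the margin is the Finsler–Debreu lemma for the
compressions `B = −VᵀAV ⪰ 0`, `P = VᵀA′V`). [folklore: first-order perturbation of a semisimple eigenvalue, Kato II.5.4 / II.6.8, in
counting form; packaging this work] -/
theorem exists_nonposCount_le_of_near_transversal {A : Matrix ι ι ℝ} (hA : A.IsHermitian) (A' : Matrix ι ι ℝ)
    (htr : ∀ v : ι → ℝ, A *ᵥ v = 0 → v ≠ 0 → 0 < v ⬝ᵥ A' *ᵥ v) :
    ∃ μ s₀ : ℝ, 0 < μ ∧ 0 < s₀ ∧ ∀ (s : ℝ), 0 < s → s ≤ s₀ → ∀ (M : Matrix ι ι ℝ) (hM : M.IsHermitian),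
      (∑ i, ∑ j, |(M - (A - s • A')) i j|) < μ * s →
      (univ.filter fun i => hA.eigenvalues i ≤ 0).card ≤ (univ.filter fun i => hM.eigenvalues i < 0).card := by
  classical
  let p : ℝ → Prop := fun x => x ≤ 0
  let V : Matrix ι {i // p (hA.eigenvalues i)} ℝ := Matrix.of fun x j => (hA.eigenvectorBasis j.1).ofLp x
  -- the compressions
  set B : Matrix {i // p (hA.eigenvalues i)} {i // p (hA.eigenvalues i)} ℝ := -(Vᵀ * A * V) with hBdef
  set P : Matrix {i // p (hA.eigenvalues i)} {i // p (hA.eigenvalues i)} ℝ := Vᵀ * A' * V with hPdef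
  have hcompr : ∀ (N : Matrix ι ι ℝ) (c : {i // p (hA.eigenvalues i)} → ℝ),
      c ⬝ᵥ (Vᵀ * N * V) *ᵥ c = (V *ᵥ c) ⬝ᵥ N *ᵥ (V *ᵥ c) := by
    intro N c
    rw [← Matrix.mulVec_mulVec, ← Matrix.mulVec_mulVec, dotProduct_mulVec, vecMul_transpose]
  have hBform : ∀ c, c ⬝ᵥ B *ᵥ c = -∑ j, hA.eigenvalues j.1 * c j ^ 2 := by
    intro c
    rw [hBdef, Matrix.neg_mulVec, dotProduct_neg, hcompr, frame_mulVec_dotProduct_mulVec hA p c]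
  have hBherm : B.IsHermitian := by
    rw [hBdef]
    refine Matrix.IsHermitian.neg ?_
    have h1 := Matrix.isHermitian_conjTranspose_mul_mul V hA
    rwa [Matrix.conjTranspose_eq_transpose_of_trivial] at h1
  have hBpsd : B.PosSemidef := by
    refine Matrix.PosSemidef.of_dotProduct_mulVec_nonneg hBherm fun c => ?_
    rw [star_trivial, hBform, ← Finset.sum_neg_distrib]
    exact Finset.sum_nonneg fun j _ => by
      have h1 : hA.eigenvalues j.1 ≤ 0 := j.2
      nlinarith [sq_nonneg (c j)]
  -- `P` is positive on `ker B`: there `c` is supported on the zero eigenvalues, so `Vc ∈ ker A`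
  have hPker : ∀ c : {i // p (hA.eigenvalues i)} → ℝ, c ≠ 0 → B *ᵥ c = 0 → 0 < c ⬝ᵥ P *ᵥ c := by
    intro c hc hBc
    have hzero : ∀ j : {i // p (hA.eigenvalues i)}, hA.eigenvalues j.1 * c j ^ 2 = 0 := by
      have hsum : ∑ j, -(hA.eigenvalues j.1 * c j ^ 2) = 0 := by
        have h1 : c ⬝ᵥ B *ᵥ c = 0 := by rw [hBc, dotProduct_zero]
        rw [hBform, ← Finset.sum_neg_distrib] at h1
        exact h1
      have hnn : ∀ j ∈ (univ : Finset {i // p (hA.eigenvalues i)}), 0 ≤ -(hA.eigenvalues j.1 * c j ^ 2) := fun j _ => by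
        have h1 : hA.eigenvalues j.1 ≤ 0 := j.2
        nlinarith [sq_nonneg (c j)]
      intro j
      have := (Finset.sum_eq_zero_iff_of_nonneg hnn).mp hsum j (Finset.mem_univ j)
      linarith
    have hkerA : A *ᵥ (V *ᵥ c) = 0 := by
      rw [mulVec_frame_mulVec hA p c]
      refine Finset.sum_eq_zero fun j _ => ?_
      have h1 : c j * hA.eigenvalues j.1 = 0 := by
        rcases mul_eq_zero.mp (hzero j) with h | h
        · rw [h, mul_zero]
        · have : c j = 0 := pow_eq_zero_iff (n := 2) (by norm_num) |>.mp h
          rw [this, zero_mul]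
      rw [h1, zero_smul]
    rw [hPdef, hcompr]
    exact htr (V *ᵥ c) hkerA (frame_mulVec_ne_zero hA p hc)
  obtain ⟨α, μ, hα, hμ, hDeb⟩ := exists_margin_of_posDef_on_ker B P hBpsd hPker
  -- `s₀ = 1/(α+1)`: for `s ≤ s₀`, `1/s ≥ α`
  refine ⟨μ / 2, 1 / (α + 1), by positivity, by positivity, fun s hs hs₀ M hM hnear => ?_⟩
  rw [← card_frame hA p]
  refine EigenvalueCount.card_le_card_eigenvalues_lt hM V fun c hc => ?_
  rw [zero_mul]
  have hcc : 0 < c ⬝ᵥ c := by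
    have h1 := dotProduct_star_self_pos_iff.mpr hc
    simpa using h1
  -- split `M = (A - s A') + (M - (A - s A'))`
  have hsplit : (V *ᵥ c) ⬝ᵥ M *ᵥ (V *ᵥ c) =
      -(c ⬝ᵥ B *ᵥ c) - s * (c ⬝ᵥ P *ᵥ c) + (V *ᵥ c) ⬝ᵥ (M - (A - s • A')) *ᵥ (V *ᵥ c) := by
    rw [hBdef, hPdef, Matrix.neg_mulVec, dotProduct_neg, hcompr, hcompr, neg_neg, Matrix.sub_mulVec, dotProduct_sub,
      Matrix.sub_mulVec, dotProduct_sub, Matrix.smul_mulVec, dotProduct_smul, smul_eq_mul]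
    ring
  have hE : (V *ᵥ c) ⬝ᵥ (M - (A - s • A')) *ᵥ (V *ᵥ c) ≤ (∑ i, ∑ j, |(M - (A - s • A')) i j|) * (c ⬝ᵥ c) := by
    rw [← frame_mulVec_dotProduct_self hA p c]
    exact (le_abs_self _).trans (abs_dotProduct_mulVec_le _ (V *ᵥ c))
  have hB0 : 0 ≤ c ⬝ᵥ B *ᵥ c := by simpa using hBpsd.dotProduct_mulVec_nonneg c
  have hDc := hDeb c
  -- `cᵀBc + s cᵀPc ≥ s (cᵀPc + α cᵀBc) ≥ s μ (c⬝c)` because `s α ≤ 1`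
  have hsα : s * α ≤ 1 := by
    have h1 : s * (α + 1) ≤ 1 := by
      calc s * (α + 1) ≤ 1 / (α + 1) * (α + 1) := mul_le_mul_of_nonneg_right hs₀ (by positivity)
        _ = 1 := by field_simp
    nlinarith [hs.le]
  have hkey : s * (μ * (c ⬝ᵥ c)) ≤ c ⬝ᵥ B *ᵥ c + s * (c ⬝ᵥ P *ᵥ c) := by
    have h1 : s * (μ * (c ⬝ᵥ c)) ≤ s * (c ⬝ᵥ P *ᵥ c) + s * α * (c ⬝ᵥ B *ᵥ c) := by nlinarith [hs.le]
    nlinarith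
  have hmul := mul_lt_mul_of_pos_right hnear hcc
  have hpos : 0 < μ * s * (c ⬝ᵥ c) := by positivity
  have hE2 : (V *ᵥ c) ⬝ᵥ (M - (A - s • A')) *ᵥ (V *ᵥ c) < μ / 2 * s * (c ⬝ᵥ c) := lt_of_le_of_lt hE hmul
  have hlin : μ / 2 * s * (c ⬝ᵥ c) = (μ * s * (c ⬝ᵥ c)) / 2 := by ring
  have hlin2 : s * (μ * (c ⬝ᵥ c)) = μ * s * (c ⬝ᵥ c) := by ring
  rw [hlin] at hE2
  rw [hlin2] at hkey
  rw [hsplit]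
  linarith

end SignedCrossing

end Summit.ValiantsHypothesis.ValiantsHypothesis.Theorems.KPlusLogSqLaw.TowerGraft
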